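import Summits.BirchSwinnertonDyer.BirchSwinnertonDyer.Theorems.PrintCf2SplitBadTwoRestrictedSelmerBottomShaEigenImage
import HarnessLib

/-!
# Crux `PrintCf2.SplitBadTwoRankOneOfFacts` (stmt-BirchSwinnertonDyer-20368), road α, stub S3c — (F2) closed up to local inputs: the `𝔮_r`-PART of a
# SELMER CLASS is the image of a class of the summand's TRUE SELMER GROUP; hence `f(𝔖_v ⊓ L_M) = {r-eigen classes of Ш ∩ im(H¹(K,E[p^∞]))}`

Cell `bsd-print-cf2`, width seat `bsd-line-cf2-p1-w7` g2, file 11 of the bottom-value lane (… p667462 `…BottomShaEigenImage`); `--supports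
stmt-BirchSwinnertonDyer-20368` (helper, Theses-free). HONEST FRAMING: nothing here closes a crux or a stub; BSD is not proved by any of this; no
summit statement is proved by this seat. No definition, no named fact, no `sorry`, no kit. beyond-print theorem: no.

WHAT. `M_r = E[𝔮_r^∞]`, `M_{r′}` complementary, `f₀` a `Γ_K`-equivariant endomorphism of `E(K̄)` acting as `r` on `M_r` and as `r′` on `M_{r′}` WITH LOCAL
POINTS MAPS (`HasLocalPointsMaps`, so that `(f₀)_*` preserves `Sel_{p^∞}(E/K)`, tree `galH1PrimaryMap_mem_selmerGroupPInfty`); `R = res_⊤`, `e` the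
eigen-projector onto `M_r`, `ι` the inclusion.
* `resH1Hom_subtype_proj_mem_map_resSubgroup_selmer` — for `y₀ ∈ Sel_{p^∞}(E/K)`: `ι_* e_* (R y₀) ∈ R(Sel_{p^∞}(E/K))` (the `M_r`-component of a
  Selmer class is a Selmer class: `ι_* e_* y = b • ((f₀)_* − N₂) y` for integers `b`, `N₂ ≡ r′` — `(f₀)_*` acts as `N₁ ≡ r` on the `M_r`-component and
  as `N₂` on the `M_{r′}`-component (p666248), and `N₁ − N₂` is invertible modulo the exponent of `y`, Bézout);
* **`proj_resSubgroup_mem_trueSelmer`** — on an imaginary quadratic base with `p = v·v̄`: `e_*(R y₀) ∈ 𝔖_v(K, M_r) ⊓ L_{M_r}` GRANTED the CM input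
  (H1″) `ι_*⁻¹(localKerOver p ⊤ K_v) ≤ ker loc_v` on `H¹(⊤, M_r)` («classes of the summand classical at `v` are locally zero at `v`»);
* **`mem_range_shaMap_of_eigen_of_mem_selmer`** — consequently every `r`-eigen class `P y₀`, `y₀ ∈ Sel_{p^∞}(E/K)`, lies in `f(𝔖_v(K, M_r) ⊓ L_{M_r})`:
  with p666248 (`⊆`) the middle factor of the bottom value counts EXACTLY the `r`-eigen classes of `Ш(E_K/K) ∩ im(H¹(K, E[p^∞]) → H¹(K, E))`
  (-w8's `C`, for `f₀` their CM isogeny), modulo `HasLocalPointsMaps f₀` (LEAD g12's local-points file) and (H1″) (T1/T4 local CM input).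

References: A. Agboola, Compositio 143 (2007) §6 (Ш(K)(𝔭*)) [Agboola2007]; K. Rubin, LNM 1716 (1999) §2 [Rubin1999].
-/

noncomputable section

open scoped Classical

set_option linter.dupNamespace false
set_option autoImplicit false

open NumberField IsDedekindDomain Field WeierstrassCurve
open Literature.NumberTheory.EllipticCurves Literature.NumberTheory.EllipticCurves.GreenbergSelmer
open Literature.NumberTheory.EllipticCurves.Castella2018.AcSelmer
open Literature.NumberTheory.EllipticCurves.Agboola2007
open Literature.NumberTheory.EllipticCurves.ResKernel
open Literature.NumberTheory.GaloisRepresentations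

universe u

namespace Summit.BirchSwinnertonDyer.BirchSwinnertonDyer.Theorems.PrintCf2.RestrictedSelmerPair

section SelmerToTrue

variable {K : Type u} [Field K] [NumberField K] (V : WeierstrassCurve K) [V.IsElliptic] (p : ℕ) [Fact p.Prime]
  (π : V.endRing) (r r' : ℤ_[p])
  (f₀ : V.geomPoints →+ V.geomPoints) (hf₀ : ∀ (σ : absoluteGaloisGroup K) (P : V.geomPoints), f₀ (σ • P) = σ • f₀ P)
  (hfr : ∀ (k : ℕ) (N : ℤ) (x : V.geomPrimaryTorsion p), x ∈ V.endEigenPrimaryTorsion p π r → p ^ k • x = 0 →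
    ((N : ℤ_[p]) - r) ∈ (Ideal.span {(p : ℤ_[p]) ^ k} : Ideal ℤ_[p]) → f₀ (x : V.geomPoints) = N • (x : V.geomPoints))
  (hfr' : ∀ (k : ℕ) (N : ℤ) (x : V.geomPrimaryTorsion p), x ∈ V.endEigenPrimaryTorsion p π r' → p ^ k • x = 0 →
    ((N : ℤ_[p]) - r') ∈ (Ideal.span {(p : ℤ_[p]) ^ k} : Ideal ℤ_[p]) → f₀ (x : V.geomPoints) = N • (x : V.geomPoints))
  (hunit : IsUnit (r - r')) (hloc : HasLocalPointsMaps V V f₀)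
  (e : V.geomPrimaryTorsion p →+ ↥(V.endEigenPrimaryTorsion p π r))
  (e' : V.geomPrimaryTorsion p →+ ↥(V.endEigenPrimaryTorsion p π r'))
  (he : ∀ (σ : absoluteGaloisGroup K) (x : V.geomPrimaryTorsion p), e (σ • x) = σ • e x)
  (he' : ∀ (σ : absoluteGaloisGroup K) (x : V.geomPrimaryTorsion p), e' (σ • x) = σ • e' x)
  (hsum : ∀ x, (e x : V.geomPrimaryTorsion p) + (e' x : V.geomPrimaryTorsion p) = x)

omit [V.IsElliptic] in
include hf₀ hfr hfr' hunit hloc he' hsum in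
/-- **The `M_r`-component of a Selmer class is (the restriction of) a Selmer class**: for `y₀ ∈ Sel_{p^∞}(E/K)`,
`ι_* e_* (res_⊤ y₀) ∈ res_⊤(Sel_{p^∞}(E/K))` — `ι_* e_* y = b • ((f₀)_* y − N₂ • y)` with `N₂ ≡ r′` and `b (N₁ − N₂) ≡ 1` modulo the exponent of `y`
(p666248 eigen relations on the two components, Bézout), and `(f₀)_*` preserves `Sel_{p^∞}` (`galH1PrimaryMap_mem_selmerGroupPInfty`).
[cite: Rubin1999, §2] [cite: Agboola2007, §6] -/
theorem resH1Hom_subtype_proj_mem_map_resSubgroup_selmer {y₀ : galH1Primary V p} (hy₀ : y₀ ∈ V.selmerGroupPInfty p) :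
    resH1Hom (ContinuousMonoidHom.id _) (V.endEigenPrimaryTorsion p π r).subtype (fun _ _ ↦ rfl)
        (resH1Hom (ContinuousMonoidHom.id _) e (fun σ x ↦ by rw [Subgroup.smul_def, Subgroup.smul_def]; exact he σ x)
          (resSubgroup (⊤ : Subgroup (absoluteGaloisGroup K)) (V.geomPrimaryTorsion p) y₀)) ∈
      (V.selmerGroupPInfty p).map (resSubgroup (⊤ : Subgroup (absoluteGaloisGroup K)) (V.geomPrimaryTorsion p)) := by
  set R := resSubgroup (⊤ : Subgroup (absoluteGaloisGroup K)) (V.geomPrimaryTorsion p) with hR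
  set y := R y₀ with hydef
  set c := resH1Hom (ContinuousMonoidHom.id _) e (fun σ x ↦ by rw [Subgroup.smul_def, Subgroup.smul_def]; exact he σ x) y with hcdef
  set c' := resH1Hom (ContinuousMonoidHom.id _) e' (fun σ x ↦ by rw [Subgroup.smul_def, Subgroup.smul_def]; exact he' σ x) y with hc'def
  set ιc := resH1Hom (ContinuousMonoidHom.id _) (V.endEigenPrimaryTorsion p π r).subtype (fun _ _ ↦ rfl) c with hιc
  set ιc' := resH1Hom (ContinuousMonoidHom.id _) (V.endEigenPrimaryTorsion p π r').subtype (fun _ _ ↦ rfl) c' with hιc'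
  -- exponent of `y₀`
  obtain ⟨J, hJ⟩ := exists_pow_smul_galH1Primary_eq_zero V p y₀
  -- `(f₀)_*` acts as `N₁` on `ιc` and as `N₂` on `ιc′`, both to order `p^J`
  obtain ⟨N₁, hN₁, h₁⟩ := exists_eigen_resH1Hom_primaryTorsionMap V p π r f₀ hf₀ hfr c J
  obtain ⟨N₂, hN₂, h₂⟩ := exists_eigen_resH1Hom_primaryTorsionMap V p π r' f₀ hf₀ hfr' c' J
  -- the splitting `ιc + ιc′ = y`
  have hsplit : ιc + ιc' = y := resH1Hom_subtype_proj_add_eq V p π r r' ⊤ e e' he he' hsum y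
  -- `π^⊤_* y = R ((f₀)_* y₀)`
  have key := ResKernel.resH1Hom_comp_resSubgroup (ContinuousMonoidHom.id (absoluteGaloisGroup K))
    (primaryTorsionMap p f₀) (primaryTorsionMap_smul p f₀ hf₀) ⊤ ⊤ (ContinuousMonoidHom.id _) (fun _ ↦ rfl)
    (fun σ x ↦ by
      rw [Subgroup.smul_def, Subgroup.smul_def]
      exact primaryTorsionMap_smul p f₀ hf₀ _ x)
  have hRy : resH1Hom (ContinuousMonoidHom.id _) (primaryTorsionMap p f₀)
      (fun σ x ↦ by
        rw [Subgroup.smul_def, Subgroup.smul_def]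
        exact primaryTorsionMap_smul p f₀ hf₀ _ x) y = R (galH1PrimaryMap p f₀ hf₀ y₀) := by
    have h := congrArg (fun g ↦ g y₀) key
    simp only [AddMonoidHom.comp_apply] at h
    rw [hydef]
    exact h
  -- `R((f₀)_* y₀ − N₂ • y₀) = (N₁ − N₂) • ιc`
  have hmain : R (galH1PrimaryMap p f₀ hf₀ y₀ - (N₂ : ℤ) • y₀) = ((N₁ : ℤ) - N₂) • ιc := by
    rw [map_sub, map_zsmul, ← hRy, ← hydef, ← hsplit, map_add, h₁, h₂, sub_zsmul, zsmul_add, natCast_zsmul, natCast_zsmul,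
      natCast_zsmul]
    abel
  -- Bézout: `b (N₁ − N₂) ≡ 1 (mod p^J)` and `p^J • ιc = 0`
  have hcop : IsCoprime ((p : ℤ) ^ J) ((N₁ : ℤ) - N₂) := by
    refine CMPrimes.isCoprime_pow_of_sub_mem_span_of_isUnit hunit ?_
    have : (((N₁ : ℤ) - N₂ : ℤ) : ℤ_[p]) - (r - r') = (((N₁ : ℤ) : ℤ_[p]) - r) - (((N₂ : ℤ) : ℤ_[p]) - r') := by push_cast; ring
    rw [this]
    exact Ideal.sub_mem _ hN₁ hN₂
  obtain ⟨a, b, hab⟩ := hcop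
  have hJc : ((p : ℤ) ^ J) • ιc = 0 := by
    have h0 : p ^ J • y = 0 := by rw [hydef, ← map_nsmul, hJ, map_zero]
    have h1 : p ^ J • ιc = 0 := by rw [hιc, hcdef, ← map_nsmul, ← map_nsmul, h0, map_zero, map_zero]
    rw [← natCast_zsmul] at h1
    exact_mod_cast h1
  have hιc_eq : ιc = b • R (galH1PrimaryMap p f₀ hf₀ y₀ - (N₂ : ℤ) • y₀) := by
    rw [hmain, ← mul_zsmul]
    calc ιc = (1 : ℤ) • ιc := (one_zsmul ιc).symm
      _ = (a * (p : ℤ) ^ J + b * ((N₁ : ℤ) - N₂)) • ιc := by rw [hab]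
      _ = (b * ((N₁ : ℤ) - N₂)) • ιc := by rw [add_zsmul, mul_zsmul, hJc, zsmul_zero, zero_add]
  rw [hιc_eq, ← map_zsmul]
  refine AddSubgroup.mem_map_of_mem _ (AddSubgroup.zsmul_mem _ (AddSubgroup.sub_mem _ ?_ (AddSubgroup.zsmul_mem _ hy₀ _)) _)
  exact galH1PrimaryMap_mem_selmerGroupPInfty p f₀ hf₀ hloc hy₀

variable (v vbar : HeightOneSpectrum (𝓞 K))

include hf₀ hfr hfr' hunit hloc he' hsum in
/-- **The `M_r`-component of a Selmer class lies in the summand's TRUE SELMER GROUP `𝔖_v(K, M_r) ⊓ L_{M_r}`** on an imaginary quadratic base with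
`p = v·v̄`, GRANTED the CM input (H1″) `ι_*⁻¹(localKerOver p ⊤ K_v) ≤ ker loc_v` (classes of the summand classical at `v` are locally zero at `v`):
classical at `v̄` (`L_{M_r}`), locally zero at `w ∤ p` (p664118), at `v` ((H1″)), nothing at infinity. [cite: Agboola2007, §3, §6] -/
theorem proj_resSubgroup_mem_trueSelmer (hK : IsImaginaryQuadratic K)
    (hinf : V.endEigenPrimaryTorsion p π r ⊓ V.endEigenPrimaryTorsion p π r' = ⊥)
    (hsup : V.endEigenPrimaryTorsion p π r ⊔ V.endEigenPrimaryTorsion p π r' = ⊤)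
    (hH1 : (V.localKerOver p ⊤ (v.adicCompletion K)).comap
        (resH1Hom (ContinuousMonoidHom.id _) (V.endEigenPrimaryTorsion p π r).subtype (fun _ _ ↦ rfl)) ≤
      (resOfLe ↥(V.endEigenPrimaryTorsion p π r) (inf_le_left : ⊤ ⊓ decomp v ≤ ⊤)).ker)
    {y₀ : galH1Primary V p} (hy₀ : y₀ ∈ V.selmerGroupPInfty p) :
    resH1Hom (ContinuousMonoidHom.id _) e (fun σ x ↦ by rw [Subgroup.smul_def, Subgroup.smul_def]; exact he σ x)
        (resSubgroup (⊤ : Subgroup (absoluteGaloisGroup K)) (V.geomPrimaryTorsion p) y₀) ∈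
      restrictedSelmerBase ↥(V.endEigenPrimaryTorsion p π r) p v ⊓
        (V.localKerOver p ⊤ (vbar.adicCompletion K)).comap
          (resH1Hom (ContinuousMonoidHom.id _) (V.endEigenPrimaryTorsion p π r).subtype (fun _ _ ↦ rfl)) := by
  set c := resH1Hom (ContinuousMonoidHom.id _) e (fun σ x ↦ by rw [Subgroup.smul_def, Subgroup.smul_def]; exact he σ x)
    (resSubgroup (⊤ : Subgroup (absoluteGaloisGroup K)) (V.geomPrimaryTorsion p) y₀) with hcdef
  have hsel := resH1Hom_subtype_proj_mem_map_resSubgroup_selmer V p π r r' f₀ hf₀ hfr hfr' hunit hloc e e' he he' hsum hy₀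
  -- `ι_* c` satisfies the classical condition at every finite completion
  have hclass : ∀ w : HeightOneSpectrum (𝓞 K),
      resH1Hom (ContinuousMonoidHom.id _) (V.endEigenPrimaryTorsion p π r).subtype (fun _ _ ↦ rfl) c ∈
        V.localKerOver p ⊤ (w.adicCompletion K) := by
    intro w
    obtain ⟨z, hz, hzc⟩ := AddSubgroup.mem_map.mp hsel
    rw [← hcdef] at hzc
    rw [← hzc]
    simp only [WeierstrassCurve.selmerGroupPInfty, AddSubgroup.mem_inf, AddSubgroup.mem_iInf] at hz
    exact V.resSubgroup_top_mem_localKerOver (hz.1 w)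
  refine AddSubgroup.mem_inf.mpr ⟨?_, AddSubgroup.mem_comap.mpr (hclass vbar)⟩
  rw [mem_restrictedSelmerBase_iff_resOfLe]
  refine ⟨fun w hw ↦ ?_, fun w ↦ resOfLe_decompInf_eq_zero_of_isComplex _ (hK.2.isComplex w) c, ?_⟩
  · exact AddMonoidHom.mem_ker.mp
      (comap_localKerOver_le_ker_resOfLe_of_not_mem V p π r r' hinf hsup w hw (AddSubgroup.mem_comap.mpr (hclass w)))
  · exact AddMonoidHom.mem_ker.mp (hH1 (AddSubgroup.mem_comap.mpr (hclass v)))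

end SelmerToTrue

end Summit.BirchSwinnertonDyer.BirchSwinnertonDyer.Theorems.PrintCf2.RestrictedSelmerPair

end
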